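import Summits.Ventures.AbcSig.Conjectures.L313FreyLocalData2

/-!
# Venture AbcSig — the slice of `CONJ_LR32_L2` at `ℓ = 313`: the `(1+i)` INERTIAL DATUM as a typed hypothesis on the residual's conclusion

HONEST FRAMING. Support file of the computation cell `pub-abcsig` (p-lean g22; lead g20 KEY «L313-INERTIA2-LEAN», item (A5);
HOME/wake/KEY-pub-abcsig-p-lean-L313-INERTIA2-LEAN.md). PART (B) OF TWO — READ FIRST part (A) `Conjectures/L313FreyLocalData2.lean` (the PROVED
Frey-side 2-adic data: in BS04 case (i) `c` is even, signature `(v₂(c₄), v₂(c₆), v₂(Δ)) = (4, 6 + v₂(c), 6)`) and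
`Conjectures/LevelRaising32L2Instance313Sympl.lean` (p544524: `CONJ_LR32_L2At_313_iff_sympl`, the residual `LR32Residual313Sympl` whose `E₁`
conclusion carries the SYMPL survivor condition `23 ∣ m ∨ (m/23) = +1`). **Kernel face of `CONJ_LR32_L2` UNCHANGED (62 PROVED + 1 REDUCED + 1 OOS /
64). This file adds ONE TYPED hypothesis schema `HI2 M T` — «every case-(i) `E₁` datum congruent above `23` to a newform matching `10016.1` has
`v₂(c) ∈ T`» — and SHARPENS THE CONCLUSION of the reduced slice accordingly (`LR32Residual313Inertia2 M T`, `CONJ_LR32_L2At_313_iff_inertia2`),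
with `T` a PARAMETER. The cell's BOOKED value is `T = {k | 2 ≤ k}` (HOME/STRUCTURE.md v3.33–v3.35 — v3.35 = referee ref-g93's wording
errata, typed content unchanged; registrar l.115–l.120 of
HOME/lead/PREDICTIONS-ODDHALVES-lead-g14.md: row «E7-L313-INERTIA2», branch (R3″) — two blind hands, engine-2 g35 and engine-1 g26, CONCUR cell for
cell with the print-derived prediction of lit g34: `K₀(E₁) = ℚ₂(√3)` iff `v₂(z) = 1`, `ℚ₂(i)` iff `v₂(z) ≥ 2`, against `G₃(E) ≅ C₈` for the
ℚ-curve of record; «a primitive xy-odd solution of Q(313; 23) in the classes m ∈ {6, 13} has v₂(z) ≥ 2, i.e. 4 ∣ z»): COMPUTED ≠ PROVED —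
`HI2 M inertia2Booked` is an HYPOTHESIS wherever taken. What the kernel PROVES here: the schema is monotone, its instance `T = {k | 1 ≤ k}`
holds UNCONDITIONALLY (part (A): `c` is even), the booked instance reads «`4 ∣ c`», and the residual equivalences. Q(313; 23) is NOT decided;
typed ≠ proved; computed ≠ proved; no row of the paper; nothing about ABC or any summit.**

THE HYPOTHESIS, LABELLED (cell vocabulary). `HI2 M T` — TYPED: the `(1+i)` INERTIAL DATUM = inside ((H), (H_id)): `E₁(S)[23]|G_{K_v} ≅ E[23]|G_{K_v}`
at `v = (1+i)`, `K_v = ℚ₂(i)`, hence equal inertial fields `K_v^un(E₁(S)[3]) = K_v^un(E[3])` ([ST68, §2]; [Kraus 1990]; [FK16, Thm. 15(3)]: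
for the signature `(4, ≥ 7, 6)`, `N = 2⁵` — PROVED for every case-(i) datum in part (A) — the inertial field is one of two, read off FK's
table by `n = v₂(c₆) = 6 + v₂(c)`), compared with the COMPUTED datum `G₃(E) ≅ C₈` of the curve of record; the comparison's OUTPUT is a set
`T` of admissible values of `v₂(c)`. Nothing of this chain is formalised (Mathlib has no local Galois representations of elliptic curves):
the schema records its output only, exactly like `HS313` / `HS223` of p544524.

WHAT IS PROVED HERE. `HI2.mono`; `HI2_one_le` (**`HI2 M {k | 1 ≤ k}` unconditionally**: part (A)'s `lr32E1Datum_caseI_two_adic`);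
`HI2.inter_one_le`; `LR32Residual313Inertia2` (the residual with the `E₁` conclusion carrying the survivor condition AND «case (i) ⇒
`v₂(c) ∈ T`»); `LR32Residual313Sympl_of_inertia2`, `LR32Residual313Inertia2_of_sympl`, `LR32Residual313Inertia2_iff`;
**`CONJ_LR32_L2At_313_iff_inertia2 : CONJ_LR32_L2At M 313 ↔ LR32Residual313Inertia2 M T` modulo EXACTLY hD, hCP, hX, hX223 (COMPUTED),
HS313, HS223 (TYPED) and HI2 M T (TYPED)**. THE PRINTED TABLE PULLED BACK: `FKField` (labels `g₁`, `g₂` of [FK22, Thm. 15(3)]), `fk22TableDa`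
([FK22, Table FoverQ2II] row `D_a` TRANSCRIBED: `g₂` iff `n = v₂(c₆) = 7`, else `g₁`), `caseI_case_Da` (PROVED: a case-(i) `E₁(S)` IS in case
`D_a`: `(4, ≥ 7, 6)` and `c̃₄ ≡ −1 (mod 4)`), **`fk22TableDa_e1CurveInt`** (PROVED: on a case-(i) `E₁(S)`
the printed field is `g₁ ↔ v₂(c) ≥ 2`, `g₂ ↔ v₂(c) = 1`, via part (A)'s `n = 6 + v₂(c)`), `HI2Field M φ` (TYPED: the inertial-field identity with
the E side's field `φ` a parameter — the cell's two hands + lit g34's dictionary give `φ = g₁`), **`HI2_of_field`** (`HI2Field M g₁ → HI2 M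
inertia2Booked`, `HI2Field M g₂ → HI2 M {1}`); `inertia2Booked = {k | 2 ≤ k}` with `mem_inertia2Booked_iff` (`v₂(c) ≥ 2 ↔ 4 ∣ c` for `c ≠ 0`),
`CONJ_LR32_L2At_313_iff_inertia2_booked`, `LR32Residual313Inertia2_booked_four_dvd`, **`CONJ_LR32_L2At_313_iff_inertia2_g₁`** (the BOOKED reading
with the E side's `φ = g₁` as the only computed input besides the framework identity: the `E₁` branch carries «case (i) ⇒ `4 ∣ c`»). So of the
booked sentence «v₂(z) ≥ 2» the Frey half (FK's table row at `n = 6 + v₂(z)`) is PRINTED ∘ PROVED, the E half (`G₃(E) ≅ C₈` ↔ `g₁`) COMPUTED +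
DERIVED, the identity between them TYPED. Successor socket for the twist-sign bit (G): `HI2Cells M 𝒯` over cells `(v₂(c), D mod 16)`
and its BOOKED instance `inertia2CellsBooked` = `{(2; 3), (2; 7)} ∪ {(k; 11), (k; 15) : k ≥ 3}` (HOME/STRUCTURE.md v3.34, registrar l.118–l.119,
booked 16:31:15Z; COMPUTED ≠ PROVED), `HI2_of_cells`, `HI2_of_cellsBooked` (both bits refine «`4 ∣ z`»), `zmod16_cells_table` (`b²³ ≡ b³`,
`313 ≡ 9 (mod 16)`), `zmod16_bwords_table` (the registrar's `b`-words dictionary, kernel-checked). No kernel-heavy step.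

WHAT THIS IS NOT. Not a proof or refutation of `CONJ_LR32_L2At M 313`, `LR32Residual313E`, `LR32Residual313Sympl` or
`LR32Residual313Inertia2 M T` for any `T` (all OPEN); `HI2 M inertia2Booked` is COMPUTED (two hands) + DERIVED (registrar/referee) + PRINTED
local facts, NOT proved; the unramified-twist sign at `(1+i)` (deliverable (G)) is NOT in this file; the statements of record (p525413, p539869,
p543565, p544524, `CONJ_LR32_L2`) are untouched; not a decision of Q(313; 23); no row; nothing about ABC or any summit. MEANINGFUL ONLY FOR
THE INTENDED MODEL, like every statement over `NewformModel`.

References: [BS04] M. A. Bennett, C. M. Skinner, Canad. J. Math. 56 (2004) 23–54; [ST68] J.-P. Serre, J. Tate, Ann. of Math. 88 (1968), §2;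
[Kraus 1990] A. Kraus, Manuscripta Math. 69 (1990) 353–385; [FK16] N. Freitas, A. Kraus, Mem. Amer. Math. Soc. 277 (2022) no. 1361
(arXiv:1607.01218), Thm. 15(3). Cell records: HOME = run/shared/lean/pub/pub-abcsig/: STRUCTURE.md v3.33–v3.35, referee/ref-g93/, lead/inertia2-lead-g20/,
lead/PREDICTIONS-ODDHALVES-lead-g14.md l.109–l.116, referee/ref-g92/, engine/engine-2/results/L313-INERTIA2-g35/, engine/engine1-0.5/notes-g26/inertia2/,
lit/INERTIA2-pins-asprinted-lit-g34.md, plean/g22/README-g22.md.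
-/

namespace Summit.Ventures.AbcSig.Conjectures

open Summit.Ventures.AbcSig

/-! ## The typed hypothesis schema -/

/-- **HYPOTHESIS `HI2 M T` (TYPED: the `(1+i)` inertial datum with output `T`).** For every newform `f` of level `2⁵·313` matching `10016.1`,
every `E₁` datum `S` of `(313; 23)` (`LR32E1Datum S m`) in BS04 case (i) as printed (`ab·AB` odd, `4 ∣ b + B`) whose Frey curve is congruent
to `f` above `23` has `v₂(c) ∈ T`. Chain (NOT formalised; TWO non-equivalent readings, referee ref-g93 (E1)): COMPUTED — (H) + (H_id) +
[ST68, §2]: `G₃(E) ≅ C₈` (two hands) ⇒ `ρ̄_{E₁(S),23}|G_{K_v}` abelian ⇒ `Gal(ℚ₂(i)(E₁(S)[3])/ℚ₂(i)) ≅ C₈` ⇒ (hands' table) `v₂(c) ≥ 2`;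
ALTERNATIVELY, without (H_id) — (H) + (S6) + [Kraus 1990] + [FK16, Thm. 15(3)] + [FK22, Table FoverQ2II] + lit g34's dictionary §5.3:
`K₀(f) = ℚ₂(i)` ⇒ field `g₁` ⇒ `n = v₂(c₆(E₁(S))) ≥ 8` ⇒ `v₂(c) ≥ 2` (the table step on `E₁(S)` is `fk22TableDa_e1CurveInt`, PROVED from
part (A)'s `n = 6 + v₂(c)`). TYPED, NOT PROVED; an HYPOTHESIS wherever taken; `T` is a PARAMETER (booked value: `inertia2Booked`). -/
def HI2 (M : NewformModel) (T : Set ℕ) : Prop :=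
  ∀ f : M.Form (2 ^ 5 * 313), M.Matches f orbit_10016_1 → ∀ (S : FreyDatum) (m : ℕ), LR32E1Datum S m →
    FreyCase.i.Holds S.A S.B S.C S.n S.a S.b S.c → CongruentToFrey M f 23 .E1 S → padicValInt 2 S.c ∈ T

/-- The schema is monotone in `T`. -/
theorem HI2.mono {M : NewformModel} {T T' : Set ℕ} (h : HI2 M T) (hT : T ⊆ T') : HI2 M T' :=
  fun f hf S m hS hcase hcong => hT (h f hf S m hS hcase hcong)

/-- **PROVED instance: `HI2 M {k | 1 ≤ k}` holds unconditionally** — in case (i) `c` is even (part (A), `lr32E1Datum_caseI_two_adic`); no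
congruence is used. (So the first instance with content is `T = {k | 2 ≤ k}`.) -/
theorem HI2_one_le (M : NewformModel) : HI2 M {k | 1 ≤ k} :=
  fun _ _ S m hS hcase _ => (lr32E1Datum_caseI_two_adic S m hS hcase).1.2.2.2

/-- Hence any `HI2 M T` may be sharpened to `HI2 M (T ∩ {k | 1 ≤ k})` for free. -/
theorem HI2.inter_one_le {M : NewformModel} {T : Set ℕ} (h : HI2 M T) : HI2 M (T ∩ {k | 1 ≤ k}) :=
  fun f hf S m hS hcase hcong => ⟨h f hf S m hS hcase hcong, HI2_one_le M f hf S m hS hcase hcong⟩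

/-! ## The residual with the conclusion sharpened by the inertial datum -/

/-- **`LR32Residual313Inertia2 M T`** — VERBATIM `LR32Residual313Sympl M` (p544524) EXCEPT that the `E₁` branch of the conclusion carries, in
addition to the SYMPL survivor condition `23 ∣ m ∨ (m/23) = +1`, the clause «if the datum is in case (i) as printed, then `v₂(c) ∈ T`».
Equivalent to `LR32Residual313Sympl M` modulo `HI2 M T` (`LR32Residual313Inertia2_iff`). OPEN for every `T`; an HYPOTHESIS wherever taken;
MEANINGFUL ONLY FOR THE INTENDED MODEL; NOT a decision of Q(313; 23). -/
def LR32Residual313Inertia2 (M : NewformModel) (T : Set ℕ) : Prop :=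
  ∀ f : M.Form (2 ^ 5 * 313), M.Matches f orbit_10016_1 → ∀ κ ∈ lr32Residual313ClassesE,
    M.ArisesMod f 23 (lr32ClassAllowed 313 23 κ) →
      ∃ (S : FreyDatum) (m : ℕ), S.n = 23 ∧ S.C = 1 ∧ 1 ≤ m ∧ Nat.Coprime S.A S.B ∧
        IsPrimitiveSolution S.A S.B 1 23 S.a S.b S.c ∧
        ((S.A * S.B = 313 ^ m ∧ CongruentToFrey M f 23 .E1 S ∧ (23 ∣ m ∨ legendreNaive 23 m = 1) ∧
            (FreyCase.i.Holds S.A S.B S.C S.n S.a S.b S.c → padicValInt 2 S.c ∈ T)) ∨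
          (S.A * S.B = 2 ^ 3 * 313 ^ m ∧ CongruentToFrey M f 23 .E2 S))

/-- Forget the inertial clause. -/
theorem LR32Residual313Sympl_of_inertia2 (M : NewformModel) (T : Set ℕ) (h : LR32Residual313Inertia2 M T) :
    LR32Residual313Sympl M := by
  intro f hf κ hκ hA
  obtain ⟨S, m, hn, hC, hm, hco, hsol, hbr⟩ := h f hf κ hκ hA
  refine ⟨S, m, hn, hC, hm, hco, hsol, ?_⟩
  rcases hbr with ⟨hAB, hcong, hsy, -⟩ | h2
  · exact Or.inl ⟨hAB, hcong, hsy⟩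
  · exact Or.inr h2

/-- **The SYMPL residual implies the sharpened one, modulo `HI2 M T`.** -/
theorem LR32Residual313Inertia2_of_sympl (M : NewformModel) (T : Set ℕ) (hI : HI2 M T) (h : LR32Residual313Sympl M) :
    LR32Residual313Inertia2 M T := by
  intro f hf κ hκ hA
  obtain ⟨S, m, hn, hC, hm, hco, hsol, hbr⟩ := h f hf κ hκ hA
  refine ⟨S, m, hn, hC, hm, hco, hsol, ?_⟩
  rcases hbr with ⟨hAB, hcong, hsy⟩ | h2
  · exact Or.inl ⟨hAB, hcong, hsy, fun hcase => hI f hf S m ⟨hn, hC, hm, hco, hsol, hAB⟩ hcase hcong⟩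
  · exact Or.inr h2

/-- **`LR32Residual313Sympl M ↔ LR32Residual313Inertia2 M T`** modulo `HI2 M T` (TYPED). -/
theorem LR32Residual313Inertia2_iff (M : NewformModel) (T : Set ℕ) (hI : HI2 M T) :
    LR32Residual313Sympl M ↔ LR32Residual313Inertia2 M T :=
  ⟨LR32Residual313Inertia2_of_sympl M T hI, LR32Residual313Sympl_of_inertia2 M T⟩

/-- **`CONJ_LR32_L2` at `ℓ = 313` with the SYMPL survivor condition and the `(1+i)` inertial datum.** Modulo EXACTLY: `hD`, `hCP`, `hX` (p525413/
p539869, COMPUTED), `hX223` (COMPUTED), `HS313`, `HS223` (TYPED local symplectic criteria, p544524) and `HI2 M T` (TYPED, this file):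
`CONJ_LR32_L2At M 313 ↔ LR32Residual313Inertia2 M T`. Kernel face UNCHANGED (62 PROVED + 1 REDUCED + 1 OOS / 64); what changes is the
CONCLUSION of the reduced slice. Q(313; 23) is NOT decided; typed ≠ proved; computed ≠ proved; nothing about ABC or any summit. -/
theorem CONJ_LR32_L2At_313_iff_inertia2 (M : NewformModel) (hD : M.DataComplete 10016 level10016Orbits)
    (hCP : M.RefinesCPSymAll 10016 level10016CP)
    (hX : ∀ f : M.Form (2 ^ 5 * 313), M.Matches f orbit_10016_1 → M.Matches f lr32X313)
    (hX223 : ∀ f : M.Form (2 ^ 5 * 313), M.Matches f orbit_10016_1 → M.Matches f lr32X313c)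
    (ε : FreyDatum → ℤ) (h313 : HS313 M ε) (h223 : HS223 M ε) (T : Set ℕ) (hI : HI2 M T) :
    CONJ_LR32_L2At M 313 ↔ LR32Residual313Inertia2 M T :=
  (CONJ_LR32_L2At_313_iff_sympl M hD hCP hX hX223 ε h313 h223).trans (LR32Residual313Inertia2_iff M T hI)

/-! ## The printed decision table [FK22, Table FoverQ2II], row `D_a`, pulled back through `n = 6 + v₂(c)` -/

/-- Labels for the two totally ramified non-Galois octic fields of [FK16/FK22, Thm. 15(3)] at `(ℓ, e, N_E) = (2, 8, 2⁵)`: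
`g₁ = x⁸ + 8x⁴ + 336`, `g₂ = x⁸ + 4x⁶ + 28x⁴ + 20` («`E` obtains good reduction over exactly one of them»). Labels only — no field is constructed. -/
inductive FKField
  | g₁
  | g₂
  deriving DecidableEq, Repr

/-- **[FK22, Table FoverQ2II], row `D_a`, TRANSCRIBED (PRINTED; lit g34 record §2.2, arxivV5.tex l.2683–2697):** in case `D_a` of [FK22, Table model]
(signature `(4, n ≥ 7, 6)`, `c̃₄ ≡ −1 (mod 4)`, `N_E = 2⁵`; `n = v₂(c₆)`) the field of good reduction is `g₂` if `n = 7` and `g₁` if `n ≥ 8`. As a function of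
`n` (values `n < 7` do not occur in case `D_a`; junk value `g₁` there). A transcription of print, not a theorem about local fields. -/
def fk22TableDa (n : ℕ) : FKField :=
  if n = 7 then .g₂ else .g₁

/-- **`E₁(S)` lies in case `D_a` of [FK22, Table model]** (case (i), `n` odd, `c ≠ 0`): signature `(4, n ≥ 7, 6)` AND `c̃₄ ≡ −1 (mod 4)`
(`c̃₄ = 4c²C² − 3D` with `D ≡ 3 (mod 4)`, part (A)); the row's `N_E = 2⁵` is [BS04, Lemma 2.1(b)], CITED. -/
theorem caseI_case_Da (S : FreyDatum) (hcase : FreyCase.i.Holds S.A S.B S.C S.n S.a S.b S.c) (hn : Odd S.n)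
    (heq : (S.A : ℤ) * S.a ^ S.n + S.B * S.b ^ S.n = S.C * S.c ^ 2) (hc0 : S.c ≠ 0) :
    padicValInt 2 (e1CurveInt S).c₄ = 4 ∧ 7 ≤ padicValInt 2 (e1CurveInt S).c₆ ∧ padicValInt 2 (e1CurveInt S).Δ = 6 ∧
      (4 : ℤ) ∣ (4 * (S.c * (S.C : ℤ)) ^ 2 - 3 * ((S.B : ℤ) * S.C * S.b ^ S.n)) + 1 := by
  obtain ⟨h4, h6, hΔ, hk⟩ := caseI_two_adic_signature S hcase heq hc0
  obtain ⟨-, hD⟩ := caseI_mod_four_int S hcase hn heq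
  refine ⟨h4, by omega, hΔ, ?_⟩
  generalize (S.c * (S.C : ℤ)) ^ 2 = t at *
  generalize (S.B : ℤ) * S.C * S.b ^ S.n = D at *
  omega

/-- **PROVED: the printed row evaluated on `E₁(S)`.** A case-(i) datum has signature `(4, 6 + v₂(c), 6)` and `c̃₄ ≡ −1 (mod 4)` (part (A)) — i.e. it
IS in case `D_a` with `n = 6 + v₂(c)` — so its printed field is `g₁` iff `v₂(c) ≥ 2` and `g₂` iff `v₂(c) = 1`: the cell's «`k ∈ {1} / {≥ 2}`» split
is the table's «`n = 7` / `n ≥ 8`» split, by the kernel. -/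
theorem fk22TableDa_e1CurveInt (S : FreyDatum) (hcase : FreyCase.i.Holds S.A S.B S.C S.n S.a S.b S.c)
    (heq : (S.A : ℤ) * S.a ^ S.n + S.B * S.b ^ S.n = S.C * S.c ^ 2) (hc0 : S.c ≠ 0) :
    (fk22TableDa (padicValInt 2 (e1CurveInt S).c₆) = .g₁ ↔ 2 ≤ padicValInt 2 S.c) ∧
      (fk22TableDa (padicValInt 2 (e1CurveInt S).c₆) = .g₂ ↔ padicValInt 2 S.c = 1) := by
  obtain ⟨-, h6, -, hk⟩ := caseI_two_adic_signature S hcase heq hc0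
  rw [h6]
  unfold fk22TableDa
  by_cases h7 : 6 + padicValInt 2 S.c = 7
  · rw [if_pos h7]; exact ⟨⟨(fun h => by cases h), (fun h => by omega)⟩, ⟨(fun _ => by omega), (fun _ => rfl)⟩⟩
  · rw [if_neg h7]; exact ⟨⟨(fun _ => by omega), (fun _ => rfl)⟩, ⟨(fun h => by cases h), (fun h => by omega)⟩⟩

/-- **HYPOTHESIS `HI2Field M φ` (TYPED: the inertial-field identity at `v = (1+i)`, with the E side's field `φ` as a parameter).** For every newform
`f` of level `2⁵·313` matching `10016.1` and every case-(i) `E₁` datum `S` of `(313; 23)` congruent to `f` above `23`, the PRINTED field of `E₁(S)`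
([FK22, Table FoverQ2II] row `D_a` at `n = v₂(c₆(E₁(S)))`) equals `φ` = the field the line attributes to the `10016.1` side at `v`. Two
non-equivalent routes to the cell's value `φ = g₁` (referee ref-g93 (E1); neither formalised): print-derived, without (H_id) — (H) + (S6)
(`K₀(f) = ℚ₂(i)`) + [Kraus 1990] + [FK16, Thm. 15(3)] + lit g34's DERIVED dictionary §5.3 (`K₀ = ℚ₂(i)` ↔ `g₁`); computed — (H) + (H_id) +
[ST68, §2, Cor. 3] + the two blind hands' `G₃(E) ≅ C₈` (engine-2 g35, engine-1 g26) + the same dictionary (`C₈ over ℚ₂(i)` ↔ `g₁`). TYPED, NOT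
PROVED; an HYPOTHESIS wherever taken; `φ` is a PARAMETER. -/
def HI2Field (M : NewformModel) (φ : FKField) : Prop :=
  ∀ f : M.Form (2 ^ 5 * 313), M.Matches f orbit_10016_1 → ∀ (S : FreyDatum) (m : ℕ), LR32E1Datum S m →
    FreyCase.i.Holds S.A S.B S.C S.n S.a S.b S.c → CongruentToFrey M f 23 .E1 S → fk22TableDa (padicValInt 2 (e1CurveInt S).c₆) = φ

/-! ## The booked instance `T = {k | 2 ≤ k}` («`4 ∣ z`») -/

/-- **The cell's BOOKED output of the `(1+i)` inertial comparison: `T = {k | 2 ≤ k}`** (HOME/STRUCTURE.md v3.33, registrar l.115–l.116: row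
«E7-L313-INERTIA2», branch (R3″); two blind hands — engine-2 g35, engine-1 g26 — CONCUR cell for cell with lit g34's print-derived prediction:
`K₀(E₁) = ℚ₂(√3)` iff `v₂(z) = 1` (incompatible with `G₃(E) ≅ C₈`), `ℚ₂(i)` iff `v₂(z) ≥ 2` (compatible), for every `m`, both orientations,
nothing beyond `k`; `k₀ = 2`). COMPUTED ≠ PROVED: `HI2 M inertia2Booked` is an HYPOTHESIS wherever taken. -/
def inertia2Booked : Set ℕ := {k | 2 ≤ k}

/-- For `c ≠ 0`: `v₂(c) ∈ inertia2Booked ↔ 4 ∣ c` — the booked sentence's «`4 ∣ z`». -/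
theorem mem_inertia2Booked_iff (c : ℤ) (hc : c ≠ 0) : padicValInt 2 c ∈ inertia2Booked ↔ (4 : ℤ) ∣ c := by
  have h := padicValInt_dvd_iff 2 c (p := 2)
  rw [show ((2 : ℕ) : ℤ) ^ 2 = 4 by norm_num] at h
  rw [h]
  exact ⟨fun hk => Or.inr hk, fun h' => h'.resolve_left hc⟩

/-- **PROVED: the booked set IS the printed table's `g₁`-row pulled back through `n = 6 + v₂(c)`** — `HI2Field M g₁ → HI2 M inertia2Booked`
(and `HI2Field M g₂ → HI2 M {1}`). So the only non-kernel inputs of the booked instance are the framework identity and the E side's `φ = g₁`. -/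
theorem HI2_of_field (M : NewformModel) :
    (HI2Field M .g₁ → HI2 M inertia2Booked) ∧ (HI2Field M .g₂ → HI2 M {1}) := by
  refine ⟨fun h f hf S m hS hcase hcong => ?_, fun h f hf S m hS hcase hcong => ?_⟩ <;>
    have hc0 : S.c ≠ 0 := fun h0 => hS.2.2.2.2.1.2.2.2.1 (by rw [h0, mul_zero])
  · exact (fk22TableDa_e1CurveInt S hcase hS.eqn hc0).1.mp (h f hf S m hS hcase hcong)
  · exact (fk22TableDa_e1CurveInt S hcase hS.eqn hc0).2.mp (h f hf S m hS hcase hcong)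

/-- **The BOOKED reading.** Modulo hD, hCP, hX, hX223 (COMPUTED), HS313, HS223 (TYPED) and `HI2 M inertia2Booked` (TYPED — the two-handed,
refereed, pinned `(1+i)` inertial datum of HOME/STRUCTURE.md v3.33): `CONJ_LR32_L2At M 313 ↔ LR32Residual313Inertia2 M inertia2Booked`, whose `E₁`
branch says: the solution's exponent class satisfies `23 ∣ m ∨ (m/23) = +1` AND, if the datum is in case (i) as printed (`xy` odd), `v₂(c) ≥ 2`,
i.e. `4 ∣ c` (`mem_inertia2Booked_iff`). Inside the cell's framework: survivors `m ∈ {6, −10} × {D1, D2}` with `4 ∣ z`. NOT a decision of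
Q(313; 23); nothing about ABC. -/
theorem CONJ_LR32_L2At_313_iff_inertia2_booked (M : NewformModel) (hD : M.DataComplete 10016 level10016Orbits)
    (hCP : M.RefinesCPSymAll 10016 level10016CP)
    (hX : ∀ f : M.Form (2 ^ 5 * 313), M.Matches f orbit_10016_1 → M.Matches f lr32X313)
    (hX223 : ∀ f : M.Form (2 ^ 5 * 313), M.Matches f orbit_10016_1 → M.Matches f lr32X313c)
    (ε : FreyDatum → ℤ) (h313 : HS313 M ε) (h223 : HS223 M ε) (hI : HI2 M inertia2Booked) :
    CONJ_LR32_L2At M 313 ↔ LR32Residual313Inertia2 M inertia2Booked :=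
  CONJ_LR32_L2At_313_iff_inertia2 M hD hCP hX hX223 ε h313 h223 inertia2Booked hI

/-- In the booked residual the inertial clause of the `E₁` branch reads «case (i) ⇒ `4 ∣ c`» (the datum's `c` is nonzero by primitivity). -/
theorem LR32Residual313Inertia2_booked_four_dvd (M : NewformModel) (h : LR32Residual313Inertia2 M inertia2Booked) :
    ∀ f : M.Form (2 ^ 5 * 313), M.Matches f orbit_10016_1 → ∀ κ ∈ lr32Residual313ClassesE,
      M.ArisesMod f 23 (lr32ClassAllowed 313 23 κ) →
        ∃ (S : FreyDatum) (m : ℕ), S.n = 23 ∧ S.C = 1 ∧ 1 ≤ m ∧ Nat.Coprime S.A S.B ∧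
          IsPrimitiveSolution S.A S.B 1 23 S.a S.b S.c ∧
          ((S.A * S.B = 313 ^ m ∧ CongruentToFrey M f 23 .E1 S ∧ (23 ∣ m ∨ legendreNaive 23 m = 1) ∧
              (FreyCase.i.Holds S.A S.B S.C S.n S.a S.b S.c → (4 : ℤ) ∣ S.c)) ∨
            (S.A * S.B = 2 ^ 3 * 313 ^ m ∧ CongruentToFrey M f 23 .E2 S)) := by
  intro f hf κ hκ hA
  obtain ⟨S, m, hn, hC, hm, hco, hsol, hbr⟩ := h f hf κ hκ hA
  refine ⟨S, m, hn, hC, hm, hco, hsol, ?_⟩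
  rcases hbr with ⟨hAB, hcong, hsy, hT⟩ | h2
  · have hc0 : S.c ≠ 0 := fun h0 => hsol.2.2.2.1 (by rw [h0, mul_zero])
    exact Or.inl ⟨hAB, hcong, hsy, fun hcase => (mem_inertia2Booked_iff S.c hc0).mp (hT hcase)⟩
  · exact Or.inr h2

/-- **The booked reading with the E side as the only computed input:** modulo hD, hCP, hX, hX223 (COMPUTED), HS313, HS223 (TYPED) and
`HI2Field M g₁` (TYPED framework identity at `(1+i)` + the two-handed `G₃(E) ≅ C₈` read as `g₁`): `CONJ_LR32_L2At M 313 ↔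
LR32Residual313Inertia2 M inertia2Booked` — the `E₁` branch carries the survivor condition and «case (i) ⇒ `4 ∣ c`». NOT a decision of Q(313; 23). -/
theorem CONJ_LR32_L2At_313_iff_inertia2_g₁ (M : NewformModel) (hD : M.DataComplete 10016 level10016Orbits)
    (hCP : M.RefinesCPSymAll 10016 level10016CP)
    (hX : ∀ f : M.Form (2 ^ 5 * 313), M.Matches f orbit_10016_1 → M.Matches f lr32X313)
    (hX223 : ∀ f : M.Form (2 ^ 5 * 313), M.Matches f orbit_10016_1 → M.Matches f lr32X313c)
    (ε : FreyDatum → ℤ) (h313 : HS313 M ε) (h223 : HS223 M ε) (hφ : HI2Field M .g₁) :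
    CONJ_LR32_L2At M 313 ↔ LR32Residual313Inertia2 M inertia2Booked :=
  CONJ_LR32_L2At_313_iff_inertia2 M hD hCP hX hX223 ε h313 h223 inertia2Booked ((HI2_of_field M).1 hφ)

/-! ## The second `(1+i)` bit (deliverable (G), BOOKED v3.34): cells `(v₂(c), D mod 16)` -/

/-- **HYPOTHESIS `HI2Cells M 𝒯` (TYPED schema for both `(1+i)` bits).** Both `(1+i)` bits of registrar l.111 — the inertial field (F) and the
unramified-twist sign (G) — have, per the two hands (engine-2 g35 16:08:34Z, engine-1 g26 16:29:41Z, CONCUR), an output depending only on the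
cell `(v₂(c), D mod 16)`, `D = B·b²³`: «every case-(i) `E₁` datum of `(313; 23)` congruent above `23` to a newform matching `10016.1` has its cell
in `𝒯`». The registrar's booked `𝒯` (rule (R5), HOME/STRUCTURE.md v3.34) is `inertia2CellsBooked` below; `HI2_of_cells` shows how a cell set
feeds the `T`-schema above (projection to `v₂(c)`). TYPED, NOT PROVED; an HYPOTHESIS wherever taken; `𝒯` is a PARAMETER. -/
def HI2Cells (M : NewformModel) (𝒯 : Set (ℕ × ZMod 16)) : Prop :=
  ∀ f : M.Form (2 ^ 5 * 313), M.Matches f orbit_10016_1 → ∀ (S : FreyDatum) (m : ℕ), LR32E1Datum S m →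
    FreyCase.i.Holds S.A S.B S.C S.n S.a S.b S.c → CongruentToFrey M f 23 .E1 S →
      (padicValInt 2 S.c, (((S.B : ℤ) * S.b ^ 23 : ℤ) : ZMod 16)) ∈ 𝒯

/-- A cell hypothesis implies the `T`-schema for the projection of `𝒯` to the first coordinate. -/
theorem HI2_of_cells (M : NewformModel) (𝒯 : Set (ℕ × ZMod 16)) (h : HI2Cells M 𝒯) : HI2 M (Prod.fst '' 𝒯) :=
  fun f hf S m hS hcase hcong => ⟨_, h f hf S m hS hcase hcong, rfl⟩

/-- Kernel table for reading the cells in the registrar's `(m, orientation, b mod 16)` words: for odd `b`, `b²³ ≡ b³ (mod 16)`, and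
`313 ≡ 9`, `313² ≡ 1 (mod 16)` (so `D = B·b²³ ≡ b³` or `9·b³` according as `B = 313^m` with `m` even or odd, `≡ b³` for `B = 1`). -/
theorem zmod16_cells_table : (∀ b : ZMod 16, (∃ t : ZMod 16, b = 2 * t + 1) → b ^ 23 = b ^ 3) ∧
    (313 : ZMod 16) = 9 ∧ (313 : ZMod 16) ^ 2 = 1 := by
  refine ⟨by decide, by decide, by decide⟩

/-- **The cell's BOOKED cell set for BOTH `(1+i)` bits** (HOME/STRUCTURE.md v3.34, registrar l.118–l.119, rule (R5); two blind hands CONCUR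
cell for cell): `𝒯 = {(2; 3), (2; 7)} ∪ {(k; 11), (k; 15) : k ≥ 3}` in `(v₂(z), D mod 16)`, `D = B·b²³` («v₂(z) = 1: inertial field incompatible;
v₂(z) = 2: twist-compatible iff D ≡ 3, 7; v₂(z) ≥ 3: iff D ≡ 11, 15 (mod 16)»). COMPUTED ≠ PROVED: `HI2Cells M inertia2CellsBooked` is an
HYPOTHESIS wherever taken; typed here only because the registrar booked it (16:31:15Z) before this file was filed. -/
def inertia2CellsBooked : Set (ℕ × ZMod 16) :=
  {p | (p.1 = 2 ∧ (p.2 = 3 ∨ p.2 = 7)) ∨ (3 ≤ p.1 ∧ (p.2 = 11 ∨ p.2 = 15))}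

/-- The booked cell set projects into the booked `v₂`-set: both bits together refine «`4 ∣ z`». -/
theorem HI2_of_cellsBooked (M : NewformModel) (h : HI2Cells M inertia2CellsBooked) : HI2 M inertia2Booked := by
  refine (HI2_of_cells M _ h).mono ?_
  rintro k ⟨p, hp, rfl⟩
  rcases hp with ⟨h2, -⟩ | ⟨h3, -⟩
  · show 2 ≤ p.1; omega
  · show 2 ≤ p.1; omega

/-- Kernel table for the registrar's `b`-words (v3.34): for `b ≡ 3 (mod 4)`, with `D ≡ b³` (`B ≡ 1 (mod 16)`: `B = 1` or `313^m`, `m` even) resp.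
`D ≡ 9b³` (`B ≡ 9`: `313^m`, `m` odd): `D ∈ {3, 7} ↔ b ∈ {7, 11}` resp. `b ∈ {3, 15}`, and `D ∈ {11, 15} ↔ b ∈ {3, 15}` resp. `b ∈ {7, 11}` (mod 16). -/
theorem zmod16_bwords_table : ∀ b : ZMod 16, (b = 3 ∨ b = 7 ∨ b = 11 ∨ b = 15) →
    ((b ^ 3 = 3 ∨ b ^ 3 = 7) ↔ (b = 7 ∨ b = 11)) ∧ ((b ^ 3 = 11 ∨ b ^ 3 = 15) ↔ (b = 3 ∨ b = 15)) ∧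
    ((9 * b ^ 3 = 3 ∨ 9 * b ^ 3 = 7) ↔ (b = 3 ∨ b = 15)) ∧ ((9 * b ^ 3 = 11 ∨ 9 * b ^ 3 = 15) ↔ (b = 7 ∨ b = 11)) := by
  decide

end Summit.Ventures.AbcSig.Conjectures
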